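import Summits.CriticalPhenomena.PercolationContinuityZ3.Theses.PercTiltedBlockers
import Summits.CriticalPhenomena.PercolationContinuityZ3.Theses.PercAnnulusCrossing
import Summits.CriticalPhenomena.PercolationContinuityZ3.Theorems.PercNonProliferationSubpolynomialBlockingStubTiling
import Summits.CriticalPhenomena.PercolationContinuityZ3.Theorems.PercNonProliferationSubpolynomialBlockingStubBlockerRSWGlue
import Summits.CriticalPhenomena.PercolationContinuityZ3.Theorems.PercTiltedBlockersTiltSquaring
import Literature.Probability.Percolation.SharpnessDCTProofs
import Literature.Probability.Percolation.LatticeWalksGM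
import HarnessLib

/-!
# Crux `CubeBlockingSeed` (stmt-CriticalPhenomena-1141), line `registered` (`Cruxes/CubeBlockingSeed/Lines/birth.lean`) —
the aspect-ratio ladder, importable

Helper file of the line lead (`--supports stmt-CriticalPhenomena-1141`). The crux
`Summit.CriticalPhenomena.PercolationContinuityZ3.Theses.PercTiltedBlockers.CubeBlockingSeed` (shared verbatim with
`…Theses.PercAnnulusCrossing.CubeBlockingSeed`) says: `∃ c > 0, ∀ n ≥ 1, β(n; n, n) ≥ c` at `p = p_c(ℤ³)`, where
`β_p(h; L, M) := P_p(no open path inside R(h;L,M) = [0,h]×[0,L]×[0,M] from the face {x₀ = 0} to the face {x₀ = h})`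
(`x₀` = height = the blocked direction). The line's skeleton cuts the crux along the TALL family
`SeedAt k :≡ ∃ c > 0, ∀ n ≥ 1, β_{p_c}(k·n; n, n) ≥ c` (crux = `SeedAt 1`) into the two registered stubs
`stub_tallSeed : ∃ k ≥ 1, SeedAt k` and `stub_halvingRung : ∀ k ≥ 1, SeedAt (2k) → SeedAt k` (both OPEN in print:
Borgs–Chayes–Kesten–Spencer finite-size hyperscaling for tubes; Benjamini–Kalai plaquette-RSW on tall boxes). The
skeleton lives under `Cruxes/` and is not importable from `Theorems/`; this file puts its PROVED part into the tree, with
every statement written out in tree vocabulary (the registered stub texts verbatim), so that the crux closes by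
`cubeBlockingSeed_of_tallSeed_of_halvingRung` the day the two stub files land:

* `blocking_mono_height` — taller boxes over the same cross-section are easier to block: `h ≤ h' → β_p(h;L,M) ≤ β_p(h';L,M)`
  (for PROBABILITIES and every `p`; `P_p` is carried by lattice configurations, `DCT16.real_mono_of_forall_subset_edgeSet`,
  and an open lattice path from `{x₀ = 0}` to `{x₀ = h'}` is clipped at its first visit to the level `x₀ = h`,
  `exists_openConnIn_le_level`; the RAW events are not nested, cf. the refutation `Theorems.not_TiltGluing`);
* `blocking_eq_real_seal_compl`, `blocking_anti_width` — the crux's `Finset.Icc` spelling is the seal event of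
  `SubpolynomialBlocking.StubBlockerRSWGlue.sealEvent_eq`, so wider boxes are harder to block by restriction
  (`StubTiling.seal_mono`): `L ≤ L' → M ≤ M' → β_p(h;L',M') ≤ β_p(h;L,M)`;
* `seedAt_mono`, `seedAt_one_of_halvingRung_pow` — the ladder: a seed moves UP the tall family for free, and DOWN along
  powers of two by the halving rung;
* `cubeBlockingSeed_of_tallSeed_of_halvingRung` (and the `…Shared…` twin for the `PercAnnulusCrossing` decl) — the line's
  composition: `stub_tallSeed → stub_halvingRung → CubeBlockingSeed`;
* `tallSeed_of_cubeBlockingSeed`, `seedAt_of_cubeBlockingSeed`, `halvingRung_of_cubeBlockingSeed` — both stubs are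
  CONSEQUENCES of the crux (honest pieces: neither is stronger than the crux; jointly they are equivalent to it,
  `cubeBlockingSeed_iff_tallSeed_and_halvingRung`).

No definitions and no notation: every blocking probability is written out (the registered stub texts verbatim); no unproved
facts are used. Coordinates in the boxes `Icc 0 ![a,b,c]`: `Theorems.TiltSquaring.mem_box0`.
-/

noncomputable section

namespace Summit.CriticalPhenomena.PercolationContinuityZ3.Theorems.CubeBlockingSeed

open MeasureTheory Literature.Probability.Percolation Literature.Probability.LatticeModels
open Summit.CriticalPhenomena.PercolationContinuityZ3.Theses

/-! ## Plumbing: coordinates, height monotonicity, width anti-monotonicity -/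

/-- **Height monotonicity** (taller boxes over the same cross-section are easier to block), for probabilities and
every `p`: `h ≤ h' → β_p(h; L, M) ≤ β_p(h'; L, M)`. Proof: `P_p`-a.e. `ω ⊆ E(ℤ³)`
(`DCT16.real_mono_of_forall_subset_edgeSet`); for such `ω` an open path inside `R(h';L,M)` from `x` (`x₀ = 0`) to `y`
(`y₀ = h' ≥ h`) changes its height by at most one per step, so it is clipped at its first visit `z` to the level
`x₀ = h` (`exists_openConnIn_le_level`), and the clipped path lies in `R(h';L,M) ∩ {x₀ ≤ h} ⊆ R(h;L,M)`.
(Grimmett 1999 §1.3–§1.4 for the lattice-path bookkeeping.) [folklore] -/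
theorem blocking_mono_height (p : unitInterval) {h h' : ℕ} (hle : h ≤ h') (L M : ℕ) :
    (bondPercolation (zdGraph 3) p).real
      {ω | ¬ ∃ x ∈ Finset.Icc (0 : Site 3) ![((h : ℕ) : ℤ), ((L : ℕ) : ℤ), ((M : ℕ) : ℤ)],
        ∃ y ∈ Finset.Icc (0 : Site 3) ![((h : ℕ) : ℤ), ((L : ℕ) : ℤ), ((M : ℕ) : ℤ)],
          x 0 = 0 ∧ y 0 = ((h : ℕ) : ℤ) ∧
            ω ∈ openConnIn ↑(Finset.Icc (0 : Site 3) ![((h : ℕ) : ℤ), ((L : ℕ) : ℤ), ((M : ℕ) : ℤ)]) x y} ≤ (bondPercolation (zdGraph 3) p).real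
        {ω | ¬ ∃ x ∈ Finset.Icc (0 : Site 3) ![((h' : ℕ) : ℤ), ((L : ℕ) : ℤ), ((M : ℕ) : ℤ)],
          ∃ y ∈ Finset.Icc (0 : Site 3) ![((h' : ℕ) : ℤ), ((L : ℕ) : ℤ), ((M : ℕ) : ℤ)],
            x 0 = 0 ∧ y 0 = ((h' : ℕ) : ℤ) ∧
              ω ∈ openConnIn ↑(Finset.Icc (0 : Site 3) ![((h' : ℕ) : ℤ), ((L : ℕ) : ℤ), ((M : ℕ) : ℤ)]) x y} := by
  refine DCT16.real_mono_of_forall_subset_edgeSet (zdGraph 3) p fun ω hω hb => ?_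
  rintro ⟨x, hx, y, hy, hx0, hy0, hxy⟩
  have hxR := TiltSquaring.mem_box0.1 hx
  have hyR := TiltSquaring.mem_box0.1 hy
  obtain ⟨z, hz, hr⟩ := exists_openConnIn_le_level (G := zdGraph 3) hω (fun w : Site 3 => w 0)
    (fun u w huw => (zdGraph_adj_apply_le huw 0).1) (h : ℤ) (show x 0 ≤ (h : ℤ) by omega)
    (show (h : ℤ) ≤ y 0 by rw [hy0]; exact_mod_cast hle) hxy
  obtain ⟨hzS, hzh⟩ := hr.2.1
  have hzR := TiltSquaring.mem_box0.1 (Finset.mem_coe.1 hzS)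
  have hzh' : z 0 ≤ (h : ℤ) := hzh
  refine hb ⟨x, TiltSquaring.mem_box0.2 ?_, z, TiltSquaring.mem_box0.2 ?_, hx0, hz, openConnIn_mono (fun w hw => ?_) x z hr⟩
  · omega
  · omega
  · obtain ⟨hw1, hw2⟩ := hw
    have hwR := TiltSquaring.mem_box0.1 (Finset.mem_coe.1 hw1)
    have hw2' : w 0 ≤ (h : ℤ) := hw2
    exact Finset.mem_coe.2 (TiltSquaring.mem_box0.2 (by omega))

/-- The crux's `Finset.Icc`/`openConnIn` spelling of "`R(h;L,M)` is blocked" is the complement of the `openCrossing`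
(seal) event of the sibling toolkit (`SubpolynomialBlocking.StubBlockerRSWGlue.sealEvent_eq`), as probabilities.
[folklore] -/
theorem blocking_eq_real_seal_compl (p : unitInterval) (h L M : ℕ) :
    (bondPercolation (zdGraph 3) p).real
      {ω | ¬ ∃ x ∈ Finset.Icc (0 : Site 3) ![((h : ℕ) : ℤ), ((L : ℕ) : ℤ), ((M : ℕ) : ℤ)],
        ∃ y ∈ Finset.Icc (0 : Site 3) ![((h : ℕ) : ℤ), ((L : ℕ) : ℤ), ((M : ℕ) : ℤ)],
          x 0 = 0 ∧ y 0 = ((h : ℕ) : ℤ) ∧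
            ω ∈ openConnIn ↑(Finset.Icc (0 : Site 3) ![((h : ℕ) : ℤ), ((L : ℕ) : ℤ), ((M : ℕ) : ℤ)]) x y} = (bondPercolation (zdGraph 3) p).real
      (openCrossing (Set.Icc (0 : Site 3) ![(h : ℤ), (L : ℤ), (M : ℤ)])
        {x | x ∈ Set.Icc (0 : Site 3) ![(h : ℤ), (L : ℤ), (M : ℤ)] ∧ x 0 = 0}
        {y | y ∈ Set.Icc (0 : Site 3) ![(h : ℤ), (L : ℤ), (M : ℤ)] ∧ y 0 = (h : ℤ)})ᶜ := by
  rw [SubpolynomialBlocking.StubBlockerRSWGlue.sealEvent_eq]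

/-- **Width anti-monotonicity** (wider boxes of the same height are harder to block), every `p`:
`L ≤ L' → M ≤ M' → β_p(h; L', M') ≤ β_p(h; L, M)` — a blocked wide box blocks its full-height sub-box (restriction of the
seal event, `SubpolynomialBlocking.StubTiling.seal_mono`). [folklore] -/
theorem blocking_anti_width (p : unitInterval) (h : ℕ) {L L' M M' : ℕ} (hL : L ≤ L') (hM : M ≤ M') :
    (bondPercolation (zdGraph 3) p).real
      {ω | ¬ ∃ x ∈ Finset.Icc (0 : Site 3) ![((h : ℕ) : ℤ), ((L' : ℕ) : ℤ), ((M' : ℕ) : ℤ)],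
        ∃ y ∈ Finset.Icc (0 : Site 3) ![((h : ℕ) : ℤ), ((L' : ℕ) : ℤ), ((M' : ℕ) : ℤ)],
          x 0 = 0 ∧ y 0 = ((h : ℕ) : ℤ) ∧
            ω ∈ openConnIn ↑(Finset.Icc (0 : Site 3) ![((h : ℕ) : ℤ), ((L' : ℕ) : ℤ), ((M' : ℕ) : ℤ)]) x y} ≤ (bondPercolation (zdGraph 3) p).real
        {ω | ¬ ∃ x ∈ Finset.Icc (0 : Site 3) ![((h : ℕ) : ℤ), ((L : ℕ) : ℤ), ((M : ℕ) : ℤ)],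
          ∃ y ∈ Finset.Icc (0 : Site 3) ![((h : ℕ) : ℤ), ((L : ℕ) : ℤ), ((M : ℕ) : ℤ)],
            x 0 = 0 ∧ y 0 = ((h : ℕ) : ℤ) ∧
              ω ∈ openConnIn ↑(Finset.Icc (0 : Site 3) ![((h : ℕ) : ℤ), ((L : ℕ) : ℤ), ((M : ℕ) : ℤ)]) x y} := by
  rw [blocking_eq_real_seal_compl, blocking_eq_real_seal_compl]
  refine measureReal_mono ?_
  have hb : (![(h : ℤ), (L : ℤ), (M : ℤ)] : Site 3) ≤ ![(h : ℤ), (L' : ℤ), (M' : ℤ)] := by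
    rw [Pi.le_def]; intro i; fin_cases i <;> simp [hL, hM]
  exact SubpolynomialBlocking.StubTiling.seal_mono (i := 0) (a := (0 : Site 3)) le_rfl hb rfl rfl

/-- `0 ≤ β_p(h; L, M)`. -/
theorem blocking_nonneg (p : unitInterval) (h L M : ℕ) : 0 ≤ (bondPercolation (zdGraph 3) p).real
        {ω | ¬ ∃ x ∈ Finset.Icc (0 : Site 3) ![((h : ℕ) : ℤ), ((L : ℕ) : ℤ), ((M : ℕ) : ℤ)],
          ∃ y ∈ Finset.Icc (0 : Site 3) ![((h : ℕ) : ℤ), ((L : ℕ) : ℤ), ((M : ℕ) : ℤ)],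
            x 0 = 0 ∧ y 0 = ((h : ℕ) : ℤ) ∧
              ω ∈ openConnIn ↑(Finset.Icc (0 : Site 3) ![((h : ℕ) : ℤ), ((L : ℕ) : ℤ), ((M : ℕ) : ℤ)]) x y} := measureReal_nonneg

/-- `β_p(h; L, M) ≤ 1`. -/
theorem blocking_le_one (p : unitInterval) (h L M : ℕ) : (bondPercolation (zdGraph 3) p).real
        {ω | ¬ ∃ x ∈ Finset.Icc (0 : Site 3) ![((h : ℕ) : ℤ), ((L : ℕ) : ℤ), ((M : ℕ) : ℤ)],
          ∃ y ∈ Finset.Icc (0 : Site 3) ![((h : ℕ) : ℤ), ((L : ℕ) : ℤ), ((M : ℕ) : ℤ)],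
            x 0 = 0 ∧ y 0 = ((h : ℕ) : ℤ) ∧
              ω ∈ openConnIn ↑(Finset.Icc (0 : Site 3) ![((h : ℕ) : ℤ), ((L : ℕ) : ℤ), ((M : ℕ) : ℤ)]) x y} ≤ 1 := measureReal_le_one

/-! ## The ladder on the tall family -/

/-- A tube seed moves UP the tall family for free: `k ≤ k' → SeedAt k → SeedAt k'` (height monotonicity). [folklore] -/
theorem seedAt_mono {k k' : ℕ} (hkk' : k ≤ k') (hs : (∃ c : ℝ, 0 < c ∧ ∀ n : ℕ, 1 ≤ n → c ≤ (bondPercolation (zdGraph 3) (criticalProbI 3)).real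
                                                       {ω | ¬ ∃ x ∈ Finset.Icc (0 : Site 3) ![((k * n : ℕ) : ℤ), ((n : ℕ) : ℤ), ((n : ℕ) : ℤ)],
                                                         ∃ y ∈ Finset.Icc (0 : Site 3) ![((k * n : ℕ) : ℤ), ((n : ℕ) : ℤ), ((n : ℕ) : ℤ)],
                                                           x 0 = 0 ∧ y 0 = ((k * n : ℕ) : ℤ) ∧
                                                             ω ∈ openConnIn ↑(Finset.Icc (0 : Site 3) ![((k * n : ℕ) : ℤ), ((n : ℕ) : ℤ), ((n : ℕ) : ℤ)]) x y})) : (∃ c : ℝ, 0 < c ∧ ∀ n : ℕ, 1 ≤ n → c ≤ (bondPercolation (zdGraph 3) (criticalProbI 3)).real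
                                                                                                                                                                    {ω | ¬ ∃ x ∈ Finset.Icc (0 : Site 3) ![((k' * n : ℕ) : ℤ), ((n : ℕ) : ℤ), ((n : ℕ) : ℤ)],
                                                                                                                                                                      ∃ y ∈ Finset.Icc (0 : Site 3) ![((k' * n : ℕ) : ℤ), ((n : ℕ) : ℤ), ((n : ℕ) : ℤ)],
                                                                                                                                                                        x 0 = 0 ∧ y 0 = ((k' * n : ℕ) : ℤ) ∧
                                                                                                                                                                          ω ∈ openConnIn ↑(Finset.Icc (0 : Site 3) ![((k' * n : ℕ) : ℤ), ((n : ℕ) : ℤ), ((n : ℕ) : ℤ)]) x y}) := by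
  obtain ⟨c, hc, hcle⟩ := hs
  exact ⟨c, hc, fun n hn => (hcle n hn).trans (blocking_mono_height (criticalProbI 3) (Nat.mul_le_mul_right n hkk') n n)⟩

/-- Descent along the powers of two by the halving rung (the registered text of `stub_halvingRung` as hypothesis):
`SeedAt (2^j) → SeedAt 1`. [folklore] -/
theorem seedAt_one_of_halvingRung_pow
    (hR : ∀ k : ℕ, 1 ≤ k →
      (∃ c : ℝ, 0 < c ∧ ∀ n : ℕ, 1 ≤ n → c ≤ (bondPercolation (zdGraph 3) (criticalProbI 3)).real
        {ω | ¬ ∃ x ∈ Finset.Icc (0 : Site 3) ![((2 * k * n : ℕ) : ℤ), ((n : ℕ) : ℤ), ((n : ℕ) : ℤ)],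
          ∃ y ∈ Finset.Icc (0 : Site 3) ![((2 * k * n : ℕ) : ℤ), ((n : ℕ) : ℤ), ((n : ℕ) : ℤ)],
            x 0 = 0 ∧ y 0 = ((2 * k * n : ℕ) : ℤ) ∧
              ω ∈ openConnIn ↑(Finset.Icc (0 : Site 3) ![((2 * k * n : ℕ) : ℤ), ((n : ℕ) : ℤ), ((n : ℕ) : ℤ)]) x y}) →
      (∃ c : ℝ, 0 < c ∧ ∀ n : ℕ, 1 ≤ n → c ≤ (bondPercolation (zdGraph 3) (criticalProbI 3)).real
        {ω | ¬ ∃ x ∈ Finset.Icc (0 : Site 3) ![((k * n : ℕ) : ℤ), ((n : ℕ) : ℤ), ((n : ℕ) : ℤ)],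
          ∃ y ∈ Finset.Icc (0 : Site 3) ![((k * n : ℕ) : ℤ), ((n : ℕ) : ℤ), ((n : ℕ) : ℤ)],
            x 0 = 0 ∧ y 0 = ((k * n : ℕ) : ℤ) ∧
              ω ∈ openConnIn ↑(Finset.Icc (0 : Site 3) ![((k * n : ℕ) : ℤ), ((n : ℕ) : ℤ), ((n : ℕ) : ℤ)]) x y})) :
    ∀ j : ℕ, (∃ c : ℝ, 0 < c ∧ ∀ n : ℕ, 1 ≤ n → c ≤ (bondPercolation (zdGraph 3) (criticalProbI 3)).real
               {ω | ¬ ∃ x ∈ Finset.Icc (0 : Site 3) ![(((2 ^ j) * n : ℕ) : ℤ), ((n : ℕ) : ℤ), ((n : ℕ) : ℤ)],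
                 ∃ y ∈ Finset.Icc (0 : Site 3) ![(((2 ^ j) * n : ℕ) : ℤ), ((n : ℕ) : ℤ), ((n : ℕ) : ℤ)],
                   x 0 = 0 ∧ y 0 = (((2 ^ j) * n : ℕ) : ℤ) ∧
                     ω ∈ openConnIn ↑(Finset.Icc (0 : Site 3) ![(((2 ^ j) * n : ℕ) : ℤ), ((n : ℕ) : ℤ), ((n : ℕ) : ℤ)]) x y}) → (∃ c : ℝ, 0 < c ∧ ∀ n : ℕ, 1 ≤ n → c ≤ (bondPercolation (zdGraph 3) (criticalProbI 3)).real
                                                                                                                                 {ω | ¬ ∃ x ∈ Finset.Icc (0 : Site 3) ![((1 * n : ℕ) : ℤ), ((n : ℕ) : ℤ), ((n : ℕ) : ℤ)],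
                                                                                                                                   ∃ y ∈ Finset.Icc (0 : Site 3) ![((1 * n : ℕ) : ℤ), ((n : ℕ) : ℤ), ((n : ℕ) : ℤ)],
                                                                                                                                     x 0 = 0 ∧ y 0 = ((1 * n : ℕ) : ℤ) ∧
                                                                                                                                       ω ∈ openConnIn ↑(Finset.Icc (0 : Site 3) ![((1 * n : ℕ) : ℤ), ((n : ℕ) : ℤ), ((n : ℕ) : ℤ)]) x y}) := by
  intro j
  induction j with
  | zero => intro h; simpa using h
  | succ j ih =>
    intro h
    rw [pow_succ'] at h
    exact ih (hR (2 ^ j) Nat.one_le_two_pow h)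

/-- The crux, read as `SeedAt 1` (definitional up to `1 * n = n`). -/
theorem cubeBlockingSeed_iff_seedAt_one : PercTiltedBlockers.CubeBlockingSeed ↔ (∃ c : ℝ, 0 < c ∧ ∀ n : ℕ, 1 ≤ n → c ≤ (bondPercolation (zdGraph 3) (criticalProbI 3)).real
                                                                                  {ω | ¬ ∃ x ∈ Finset.Icc (0 : Site 3) ![((1 * n : ℕ) : ℤ), ((n : ℕ) : ℤ), ((n : ℕ) : ℤ)],
                                                                                    ∃ y ∈ Finset.Icc (0 : Site 3) ![((1 * n : ℕ) : ℤ), ((n : ℕ) : ℤ), ((n : ℕ) : ℤ)],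
                                                                                      x 0 = 0 ∧ y 0 = ((1 * n : ℕ) : ℤ) ∧
                                                                                        ω ∈ openConnIn ↑(Finset.Icc (0 : Site 3) ![((1 * n : ℕ) : ℤ), ((n : ℕ) : ℤ), ((n : ℕ) : ℤ)]) x y}) := by
  simp only [PercTiltedBlockers.CubeBlockingSeed, one_mul]

/-- **The line's composition, importable**: the registered texts of `stub_tallSeed` (`∃ k ≥ 1, SeedAt k`) and
`stub_halvingRung` (`∀ k ≥ 1, SeedAt (2k) → SeedAt k`) imply the crux
`Summit.CriticalPhenomena.PercolationContinuityZ3.Theses.PercTiltedBlockers.CubeBlockingSeed`: lift the seed from aspect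
`k₀` to `2^{k₀} ≥ k₀` (`seedAt_mono`), descend to aspect `1` (`seedAt_one_of_halvingRung_pow`). [folklore] -/
theorem cubeBlockingSeed_of_tallSeed_of_halvingRung
    (hT : ∃ k : ℕ, 1 ≤ k ∧ (∃ c : ℝ, 0 < c ∧ ∀ n : ℕ, 1 ≤ n → c ≤ (bondPercolation (zdGraph 3) (criticalProbI 3)).real
        {ω | ¬ ∃ x ∈ Finset.Icc (0 : Site 3) ![((k * n : ℕ) : ℤ), ((n : ℕ) : ℤ), ((n : ℕ) : ℤ)],
          ∃ y ∈ Finset.Icc (0 : Site 3) ![((k * n : ℕ) : ℤ), ((n : ℕ) : ℤ), ((n : ℕ) : ℤ)],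
            x 0 = 0 ∧ y 0 = ((k * n : ℕ) : ℤ) ∧
              ω ∈ openConnIn ↑(Finset.Icc (0 : Site 3) ![((k * n : ℕ) : ℤ), ((n : ℕ) : ℤ), ((n : ℕ) : ℤ)]) x y}))
    (hR : ∀ k : ℕ, 1 ≤ k →
      (∃ c : ℝ, 0 < c ∧ ∀ n : ℕ, 1 ≤ n → c ≤ (bondPercolation (zdGraph 3) (criticalProbI 3)).real
        {ω | ¬ ∃ x ∈ Finset.Icc (0 : Site 3) ![((2 * k * n : ℕ) : ℤ), ((n : ℕ) : ℤ), ((n : ℕ) : ℤ)],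
          ∃ y ∈ Finset.Icc (0 : Site 3) ![((2 * k * n : ℕ) : ℤ), ((n : ℕ) : ℤ), ((n : ℕ) : ℤ)],
            x 0 = 0 ∧ y 0 = ((2 * k * n : ℕ) : ℤ) ∧
              ω ∈ openConnIn ↑(Finset.Icc (0 : Site 3) ![((2 * k * n : ℕ) : ℤ), ((n : ℕ) : ℤ), ((n : ℕ) : ℤ)]) x y}) →
      (∃ c : ℝ, 0 < c ∧ ∀ n : ℕ, 1 ≤ n → c ≤ (bondPercolation (zdGraph 3) (criticalProbI 3)).real
        {ω | ¬ ∃ x ∈ Finset.Icc (0 : Site 3) ![((k * n : ℕ) : ℤ), ((n : ℕ) : ℤ), ((n : ℕ) : ℤ)],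
          ∃ y ∈ Finset.Icc (0 : Site 3) ![((k * n : ℕ) : ℤ), ((n : ℕ) : ℤ), ((n : ℕ) : ℤ)],
            x 0 = 0 ∧ y 0 = ((k * n : ℕ) : ℤ) ∧
              ω ∈ openConnIn ↑(Finset.Icc (0 : Site 3) ![((k * n : ℕ) : ℤ), ((n : ℕ) : ℤ), ((n : ℕ) : ℤ)]) x y})) :
    PercTiltedBlockers.CubeBlockingSeed := by
  obtain ⟨k, -, hs⟩ := hT
  exact cubeBlockingSeed_iff_seedAt_one.2
    (seedAt_one_of_halvingRung_pow hR k (seedAt_mono Nat.lt_two_pow_self.le hs))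

/-- The item is SHARED: the `PercAnnulusCrossing` decl has the identical body (definitional). -/
theorem cubeBlockingSeed_shared_iff :
    PercAnnulusCrossing.CubeBlockingSeed ↔ PercTiltedBlockers.CubeBlockingSeed := Iff.rfl

/-- The composition for the item's primary decl `…Theses.PercAnnulusCrossing.CubeBlockingSeed`. [folklore] -/
theorem cubeBlockingSeedShared_of_tallSeed_of_halvingRung
    (hT : ∃ k : ℕ, 1 ≤ k ∧ (∃ c : ℝ, 0 < c ∧ ∀ n : ℕ, 1 ≤ n → c ≤ (bondPercolation (zdGraph 3) (criticalProbI 3)).real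
        {ω | ¬ ∃ x ∈ Finset.Icc (0 : Site 3) ![((k * n : ℕ) : ℤ), ((n : ℕ) : ℤ), ((n : ℕ) : ℤ)],
          ∃ y ∈ Finset.Icc (0 : Site 3) ![((k * n : ℕ) : ℤ), ((n : ℕ) : ℤ), ((n : ℕ) : ℤ)],
            x 0 = 0 ∧ y 0 = ((k * n : ℕ) : ℤ) ∧
              ω ∈ openConnIn ↑(Finset.Icc (0 : Site 3) ![((k * n : ℕ) : ℤ), ((n : ℕ) : ℤ), ((n : ℕ) : ℤ)]) x y}))
    (hR : ∀ k : ℕ, 1 ≤ k →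
      (∃ c : ℝ, 0 < c ∧ ∀ n : ℕ, 1 ≤ n → c ≤ (bondPercolation (zdGraph 3) (criticalProbI 3)).real
        {ω | ¬ ∃ x ∈ Finset.Icc (0 : Site 3) ![((2 * k * n : ℕ) : ℤ), ((n : ℕ) : ℤ), ((n : ℕ) : ℤ)],
          ∃ y ∈ Finset.Icc (0 : Site 3) ![((2 * k * n : ℕ) : ℤ), ((n : ℕ) : ℤ), ((n : ℕ) : ℤ)],
            x 0 = 0 ∧ y 0 = ((2 * k * n : ℕ) : ℤ) ∧
              ω ∈ openConnIn ↑(Finset.Icc (0 : Site 3) ![((2 * k * n : ℕ) : ℤ), ((n : ℕ) : ℤ), ((n : ℕ) : ℤ)]) x y}) →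
      (∃ c : ℝ, 0 < c ∧ ∀ n : ℕ, 1 ≤ n → c ≤ (bondPercolation (zdGraph 3) (criticalProbI 3)).real
        {ω | ¬ ∃ x ∈ Finset.Icc (0 : Site 3) ![((k * n : ℕ) : ℤ), ((n : ℕ) : ℤ), ((n : ℕ) : ℤ)],
          ∃ y ∈ Finset.Icc (0 : Site 3) ![((k * n : ℕ) : ℤ), ((n : ℕ) : ℤ), ((n : ℕ) : ℤ)],
            x 0 = 0 ∧ y 0 = ((k * n : ℕ) : ℤ) ∧
              ω ∈ openConnIn ↑(Finset.Icc (0 : Site 3) ![((k * n : ℕ) : ℤ), ((n : ℕ) : ℤ), ((n : ℕ) : ℤ)]) x y})) :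
    PercAnnulusCrossing.CubeBlockingSeed :=
  cubeBlockingSeed_shared_iff.2 (cubeBlockingSeed_of_tallSeed_of_halvingRung hT hR)

/-! ## Honest pieces: both stubs are consequences of the crux -/

/-- The crux gives every tube seed: `CubeBlockingSeed → ∀ k ≥ 1, SeedAt k` (height monotonicity). [folklore] -/
theorem seedAt_of_cubeBlockingSeed (h : PercTiltedBlockers.CubeBlockingSeed) {k : ℕ} (hk : 1 ≤ k) : (∃ c : ℝ, 0 < c ∧ ∀ n : ℕ, 1 ≤ n → c ≤ (bondPercolation (zdGraph 3) (criticalProbI 3)).real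
                                                                                                      {ω | ¬ ∃ x ∈ Finset.Icc (0 : Site 3) ![((k * n : ℕ) : ℤ), ((n : ℕ) : ℤ), ((n : ℕ) : ℤ)],
                                                                                                        ∃ y ∈ Finset.Icc (0 : Site 3) ![((k * n : ℕ) : ℤ), ((n : ℕ) : ℤ), ((n : ℕ) : ℤ)],
                                                                                                          x 0 = 0 ∧ y 0 = ((k * n : ℕ) : ℤ) ∧
                                                                                                            ω ∈ openConnIn ↑(Finset.Icc (0 : Site 3) ![((k * n : ℕ) : ℤ), ((n : ℕ) : ℤ), ((n : ℕ) : ℤ)]) x y}) :=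
  seedAt_mono hk (cubeBlockingSeed_iff_seedAt_one.1 h)

/-- The crux implies the registered text of `stub_tallSeed` (with `k = 1`). [folklore] -/
theorem tallSeed_of_cubeBlockingSeed (h : PercTiltedBlockers.CubeBlockingSeed) :
    ∃ k : ℕ, 1 ≤ k ∧ (∃ c : ℝ, 0 < c ∧ ∀ n : ℕ, 1 ≤ n → c ≤ (bondPercolation (zdGraph 3) (criticalProbI 3)).real
        {ω | ¬ ∃ x ∈ Finset.Icc (0 : Site 3) ![((k * n : ℕ) : ℤ), ((n : ℕ) : ℤ), ((n : ℕ) : ℤ)],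
          ∃ y ∈ Finset.Icc (0 : Site 3) ![((k * n : ℕ) : ℤ), ((n : ℕ) : ℤ), ((n : ℕ) : ℤ)],
            x 0 = 0 ∧ y 0 = ((k * n : ℕ) : ℤ) ∧
              ω ∈ openConnIn ↑(Finset.Icc (0 : Site 3) ![((k * n : ℕ) : ℤ), ((n : ℕ) : ℤ), ((n : ℕ) : ℤ)]) x y}) :=
  ⟨1, le_rfl, seedAt_of_cubeBlockingSeed h le_rfl⟩

/-- The crux implies the registered text of `stub_halvingRung` (its conclusion outright). [folklore] -/
theorem halvingRung_of_cubeBlockingSeed (h : PercTiltedBlockers.CubeBlockingSeed) :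
    ∀ k : ℕ, 1 ≤ k →
      (∃ c : ℝ, 0 < c ∧ ∀ n : ℕ, 1 ≤ n → c ≤ (bondPercolation (zdGraph 3) (criticalProbI 3)).real
        {ω | ¬ ∃ x ∈ Finset.Icc (0 : Site 3) ![((2 * k * n : ℕ) : ℤ), ((n : ℕ) : ℤ), ((n : ℕ) : ℤ)],
          ∃ y ∈ Finset.Icc (0 : Site 3) ![((2 * k * n : ℕ) : ℤ), ((n : ℕ) : ℤ), ((n : ℕ) : ℤ)],
            x 0 = 0 ∧ y 0 = ((2 * k * n : ℕ) : ℤ) ∧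
              ω ∈ openConnIn ↑(Finset.Icc (0 : Site 3) ![((2 * k * n : ℕ) : ℤ), ((n : ℕ) : ℤ), ((n : ℕ) : ℤ)]) x y}) →
      (∃ c : ℝ, 0 < c ∧ ∀ n : ℕ, 1 ≤ n → c ≤ (bondPercolation (zdGraph 3) (criticalProbI 3)).real
        {ω | ¬ ∃ x ∈ Finset.Icc (0 : Site 3) ![((k * n : ℕ) : ℤ), ((n : ℕ) : ℤ), ((n : ℕ) : ℤ)],
          ∃ y ∈ Finset.Icc (0 : Site 3) ![((k * n : ℕ) : ℤ), ((n : ℕ) : ℤ), ((n : ℕ) : ℤ)],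
            x 0 = 0 ∧ y 0 = ((k * n : ℕ) : ℤ) ∧
              ω ∈ openConnIn ↑(Finset.Icc (0 : Site 3) ![((k * n : ℕ) : ℤ), ((n : ℕ) : ℤ), ((n : ℕ) : ℤ)]) x y}) :=
  fun _ hk _ => seedAt_of_cubeBlockingSeed h hk

/-- **The cut is exact**: the crux is EQUIVALENT to the conjunction of the two registered stub texts. [folklore] -/
theorem cubeBlockingSeed_iff_tallSeed_and_halvingRung :
    PercTiltedBlockers.CubeBlockingSeed ↔
      ((∃ k : ℕ, 1 ≤ k ∧ (∃ c : ℝ, 0 < c ∧ ∀ n : ℕ, 1 ≤ n → c ≤ (bondPercolation (zdGraph 3) (criticalProbI 3)).real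
        {ω | ¬ ∃ x ∈ Finset.Icc (0 : Site 3) ![((k * n : ℕ) : ℤ), ((n : ℕ) : ℤ), ((n : ℕ) : ℤ)],
          ∃ y ∈ Finset.Icc (0 : Site 3) ![((k * n : ℕ) : ℤ), ((n : ℕ) : ℤ), ((n : ℕ) : ℤ)],
            x 0 = 0 ∧ y 0 = ((k * n : ℕ) : ℤ) ∧
              ω ∈ openConnIn ↑(Finset.Icc (0 : Site 3) ![((k * n : ℕ) : ℤ), ((n : ℕ) : ℤ), ((n : ℕ) : ℤ)]) x y})) ∧
        ∀ k : ℕ, 1 ≤ k →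
          (∃ c : ℝ, 0 < c ∧ ∀ n : ℕ, 1 ≤ n → c ≤ (bondPercolation (zdGraph 3) (criticalProbI 3)).real
        {ω | ¬ ∃ x ∈ Finset.Icc (0 : Site 3) ![((2 * k * n : ℕ) : ℤ), ((n : ℕ) : ℤ), ((n : ℕ) : ℤ)],
          ∃ y ∈ Finset.Icc (0 : Site 3) ![((2 * k * n : ℕ) : ℤ), ((n : ℕ) : ℤ), ((n : ℕ) : ℤ)],
            x 0 = 0 ∧ y 0 = ((2 * k * n : ℕ) : ℤ) ∧
              ω ∈ openConnIn ↑(Finset.Icc (0 : Site 3) ![((2 * k * n : ℕ) : ℤ), ((n : ℕ) : ℤ), ((n : ℕ) : ℤ)]) x y}) →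
          (∃ c : ℝ, 0 < c ∧ ∀ n : ℕ, 1 ≤ n → c ≤ (bondPercolation (zdGraph 3) (criticalProbI 3)).real
        {ω | ¬ ∃ x ∈ Finset.Icc (0 : Site 3) ![((k * n : ℕ) : ℤ), ((n : ℕ) : ℤ), ((n : ℕ) : ℤ)],
          ∃ y ∈ Finset.Icc (0 : Site 3) ![((k * n : ℕ) : ℤ), ((n : ℕ) : ℤ), ((n : ℕ) : ℤ)],
            x 0 = 0 ∧ y 0 = ((k * n : ℕ) : ℤ) ∧
              ω ∈ openConnIn ↑(Finset.Icc (0 : Site 3) ![((k * n : ℕ) : ℤ), ((n : ℕ) : ℤ), ((n : ℕ) : ℤ)]) x y})) :=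
  ⟨fun h => ⟨tallSeed_of_cubeBlockingSeed h, halvingRung_of_cubeBlockingSeed h⟩,
    fun h => cubeBlockingSeed_of_tallSeed_of_halvingRung h.1 h.2⟩


/-! ## The registered glue `stub_ladder` -/

/-- **`stub_ladder`** (registered on stmt-CriticalPhenomena-1141; the line's glue in the registered spelling): the text
of `stub_tallSeed` and the text of the halving rung imply the crux's body
(`∃ c > 0, ∀ n ≥ 1, c ≤ P_{p_c}([0,n]³ blocked face-to-face)`, definitionally
`Theses.PercTiltedBlockers.CubeBlockingSeed`). [folklore] -/
theorem stub_ladder :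
    (∃ k : ℕ, 1 ≤ k ∧ ∃ c : ℝ, 0 < c ∧ ∀ n : ℕ, 1 ≤ n →
        c ≤ (bondPercolation (zdGraph 3) (criticalProbI 3)).real
            {ω | ¬ ∃ x ∈ Finset.Icc (0 : Site 3) ![((k * n : ℕ) : ℤ), n, n],
              ∃ y ∈ Finset.Icc (0 : Site 3) ![((k * n : ℕ) : ℤ), n, n],
                x 0 = 0 ∧ y 0 = ((k * n : ℕ) : ℤ) ∧
                  ω ∈ openConnIn ↑(Finset.Icc (0 : Site 3) ![((k * n : ℕ) : ℤ), n, n]) x y}) →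
      (∀ k : ℕ, 1 ≤ k →
        (∃ c : ℝ, 0 < c ∧ ∀ n : ℕ, 1 ≤ n →
          c ≤ (bondPercolation (zdGraph 3) (criticalProbI 3)).real
            {ω | ¬ ∃ x ∈ Finset.Icc (0 : Site 3) ![((2 * k * n : ℕ) : ℤ), n, n],
              ∃ y ∈ Finset.Icc (0 : Site 3) ![((2 * k * n : ℕ) : ℤ), n, n],
                x 0 = 0 ∧ y 0 = ((2 * k * n : ℕ) : ℤ) ∧
                  ω ∈ openConnIn ↑(Finset.Icc (0 : Site 3) ![((2 * k * n : ℕ) : ℤ), n, n]) x y}) →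
        ∃ c : ℝ, 0 < c ∧ ∀ n : ℕ, 1 ≤ n →
          c ≤ (bondPercolation (zdGraph 3) (criticalProbI 3)).real
            {ω | ¬ ∃ x ∈ Finset.Icc (0 : Site 3) ![((k * n : ℕ) : ℤ), n, n],
              ∃ y ∈ Finset.Icc (0 : Site 3) ![((k * n : ℕ) : ℤ), n, n],
                x 0 = 0 ∧ y 0 = ((k * n : ℕ) : ℤ) ∧
                  ω ∈ openConnIn ↑(Finset.Icc (0 : Site 3) ![((k * n : ℕ) : ℤ), n, n]) x y}) →
      ∃ c : ℝ, 0 < c ∧ ∀ n : ℕ, 1 ≤ n → c ≤ (bondPercolation (zdGraph 3) (criticalProbI 3)).real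
        {ω | ¬ ∃ x ∈ Finset.Icc (0 : Site 3) ![(n : ℤ), n, n], ∃ y ∈ Finset.Icc (0 : Site 3) ![(n : ℤ), n, n],
          x 0 = 0 ∧ y 0 = n ∧ ω ∈ openConnIn ↑(Finset.Icc (0 : Site 3) ![(n : ℤ), n, n]) x y} :=
  fun hT hR => cubeBlockingSeed_of_tallSeed_of_halvingRung hT hR

end Summit.CriticalPhenomena.PercolationContinuityZ3.Theorems.CubeBlockingSeed

end
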